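import Mathlib.GroupTheory.Index
import Mathlib.GroupTheory.OrderOfElement
import Mathlib.GroupTheory.QuotientGroup.Basic
import Mathlib.GroupTheory.Commutator.Basic
import Mathlib.Data.ZMod.QuotientGroup
import Mathlib.Data.Nat.Prime.Basic
import Mathlib.Algebra.BigOperators.Group.Finset.Basic
import Mathlib.Algebra.Order.BigOperators.Group.Finset
import Mathlib.Tactic.Linarith
import Mathlib.Tactic.Ring
import HarnessLib

/-!
# Counting lemmas behind the numerical criteria of [CombGC] §1 (Rmks. 1.4.2, 1.4.4; [IUTchI] Rmk. 1.2.3)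

Mochizuki, *A combinatorial version of the Grothendieck conjecture*, Tohoku Math. J. **59** (2007)
[CombGC], §1, Remarks 1.4.2 and 1.4.4 (author's manuscript pp. 11–12), as amended by [IUTchI]
Remark 1.2.3 (iii), (v) (pp. 41, 43), assert numerical criteria "one verifies immediately" for a
Galois covering of degree a positive power of `l` to be (cuspidally / verticially) purely totally
ramified, and — for CYCLIC coverings of `l`-power degree — a criterion in terms of the unique
intermediate covering of degree `l`.  This file isolates the two pieces of finite group theory /
arithmetic that these verifications consist of, in a form independent of semi-graphs of
anabelioids (they are used by `PSCRamificationProofs.lean`):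

* `sum_quot_eq_iff` — for `l` prime, `0 < k` and natural numbers `q i ∣ l ^ k` indexed by a finite
  type, `∑ i, q i = l ^ k · (#ι − 1) + 1` holds iff exactly one `q i` equals `1` and all the others
  equal `l ^ k` (the count of cusps / vertices of a Galois covering of degree `l ^ k` over each cusp /
  vertex of the base is such a `q`); [cite: MochizukiCombGC2007, Rmk 1.4.2 p.11]
* `exists_frattini_of_cyclic_quotient` — for `U ⊴ P`, `H = U · ⟨g⟩` with `[H : U] = l ^ j`,
  `0 < j`: there is `M` with `U ≤ M < H`, `[H : M] = l`, such that a subgroup `E ≤ H` satisfies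
  `U · E = H` iff `E ⊄ M` (the cyclic group `H / U` of prime-power order has a unique maximal
  proper subgroup); [cite: MochizukiCombGC2007, Rmk 1.4.4 p.12]
* `commutator_le_of_sup_zpowers_eq` — `[H, H] ≤ U` in that situation.

Pure group theory over Mathlib; no statement of the papers is restated here. [folklore]
-/

namespace Literature.AnabelianGeometry.SemiGraphs

namespace PSCCounting

open Subgroup

/-! ### The arithmetic of Remark 1.4.2 -/

section Counting

variable {ι : Type*} [Fintype ι] [DecidableEq ι]

/-- A divisor of `l ^ k` (`l` prime) other than `l ^ k` itself is at most `l ^ k / l`, i.e.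
`q * l ≤ l ^ k`. [folklore] -/
private theorem mul_le_of_dvd_prime_pow_of_ne {l k q : ℕ} (hl : l.Prime) (hq : q ∣ l ^ k)
    (hne : q ≠ l ^ k) : q * l ≤ l ^ k := by
  obtain ⟨m, hm, rfl⟩ := (Nat.dvd_prime_pow hl).mp hq
  have hmk : m < k := lt_of_le_of_ne hm fun h => hne (by rw [h])
  calc l ^ m * l = l ^ (m + 1) := by ring
    _ ≤ l ^ k := Nat.pow_le_pow_right hl.pos hmk

/-- **The count criterion** ([CombGC] Rmk. 1.4.2, p. 11, arithmetic core): for `l` prime,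
`0 < k`, and `q : ι → ℕ` with every `q i ∣ l ^ k` (`ι` finite), one has
`∑ i, q i = l ^ k · (#ι − 1) + 1` (in `ℤ`) iff there is an index `i` with `q i = 1` and
`q j = l ^ k` for all `j ≠ i`. [cite: MochizukiCombGC2007, Rmk 1.4.2 p.11] -/
theorem sum_quot_eq_iff {l k : ℕ} (hl : l.Prime) (hk : 0 < k) (q : ι → ℕ)
    (hq : ∀ i, q i ∣ l ^ k) :
    ((∑ i, q i : ℕ) : ℤ) = ((l ^ k : ℕ) : ℤ) * ((Fintype.card ι : ℤ) - 1) + 1 ↔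
      ∃ i, q i = 1 ∧ ∀ j, j ≠ i → q j = l ^ k := by
  set d := l ^ k with hd
  have hl2 : 2 ≤ l := hl.two_le
  have hd2 : 2 ≤ d := by
    calc 2 ≤ l := hl2
      _ = l ^ 1 := (pow_one l).symm
      _ ≤ l ^ k := Nat.pow_le_pow_right hl.pos hk
  have hle : ∀ j, q j ≤ d := fun j => Nat.le_of_dvd (by positivity) (hq j)
  -- splitting off one index
  have hsplit : ∀ i, (∑ j, q j) = q i + ∑ j ∈ Finset.univ.erase i, q j := fun i =>
    (Finset.add_sum_erase Finset.univ q (Finset.mem_univ i)).symm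
  have hcard : ∀ i : ι, (Finset.univ.erase i).card = Fintype.card ι - 1 := fun i =>
    Finset.card_erase_of_mem (Finset.mem_univ i)
  have hcard1 : ∀ _i : ι, 1 ≤ Fintype.card ι := fun i => Fintype.card_pos_iff.mpr ⟨i⟩
  constructor
  · intro h
    -- some index is "ramified"
    have hex : ∃ i, q i ≠ d := by
      by_contra hall
      push Not at hall
      have hsum : (∑ j, q j) = Fintype.card ι * d := by
        rw [Finset.sum_congr rfl fun j _ => hall j, Finset.sum_const, smul_eq_mul,
          Finset.card_univ]
      rw [hsum] at h
      push_cast at h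
      nlinarith
    obtain ⟨i, hi⟩ := hex
    -- no second ramified index
    have huniq : ∀ j, j ≠ i → q j = d := by
      intro j hji
      by_contra hj
      have hi' := mul_le_of_dvd_prime_pow_of_ne hl (hq i) hi
      have hj' := mul_le_of_dvd_prime_pow_of_ne hl (hq j) hj
      -- split off `i` and `j`
      have hmem : j ∈ Finset.univ.erase i := Finset.mem_erase.mpr ⟨hji, Finset.mem_univ j⟩
      have hsplit2 : (∑ x ∈ Finset.univ.erase i, q x) =
          q j + ∑ x ∈ (Finset.univ.erase i).erase j, q x :=
        (Finset.add_sum_erase _ q hmem).symm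
      have hrest : (∑ x ∈ (Finset.univ.erase i).erase j, q x) ≤
          ((Finset.univ.erase i).erase j).card * d := by
        simpa [smul_eq_mul] using Finset.sum_le_card_nsmul _ _ d fun x _ => hle x
      have hcard2 : ((Finset.univ.erase i).erase j).card = Fintype.card ι - 2 := by
        rw [Finset.card_erase_of_mem hmem, hcard i]
        omega
      have h2 : 2 ≤ Fintype.card ι := by
        have : ({i, j} : Finset ι).card ≤ Fintype.card ι := Finset.card_le_univ _
        rwa [Finset.card_pair hji.symm] at this
      rw [hcard2] at hrest
      have hrest' : ((∑ x ∈ (Finset.univ.erase i).erase j, q x : ℕ) : ℤ) ≤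
          ((Fintype.card ι : ℤ) - 2) * (d : ℤ) := by
        have := (Int.ofNat_le).mpr hrest
        push_cast [Nat.cast_sub h2] at this
        exact this
      have hqi2 : q i * 2 ≤ d := le_trans (Nat.mul_le_mul_left (q i) hl2) hi'
      have hqj2 : q j * 2 ≤ d := le_trans (Nat.mul_le_mul_left (q j) hl2) hj'
      rw [hsplit i, hsplit2] at h
      push_cast at h
      have hqi2' : ((q i : ℕ) : ℤ) * 2 ≤ (d : ℤ) := by exact_mod_cast hqi2
      have hqj2' : ((q j : ℕ) : ℤ) * 2 ≤ (d : ℤ) := by exact_mod_cast hqj2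
      linarith
    refine ⟨i, ?_, huniq⟩
    -- the value at `i`
    have hsum : (∑ j ∈ Finset.univ.erase i, q j) = (Fintype.card ι - 1) * d := by
      rw [Finset.sum_congr rfl fun j hj => huniq j (Finset.mem_erase.mp hj).1, Finset.sum_const,
        smul_eq_mul, hcard i]
    rw [hsplit i, hsum] at h
    push_cast [Nat.cast_sub (hcard1 i)] at h
    have : (q i : ℤ) = 1 := by linarith
    exact_mod_cast this
  · rintro ⟨i, hi, hj⟩
    have hsum : (∑ j ∈ Finset.univ.erase i, q j) = (Fintype.card ι - 1) * d := by
      rw [Finset.sum_congr rfl fun j hj' => hj j (Finset.mem_erase.mp hj').1, Finset.sum_const,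
        smul_eq_mul, hcard i]
    rw [hsplit i, hsum, hi]
    push_cast [Nat.cast_sub (hcard1 i)]
    ring

end Counting

/-! ### Cyclic quotients of prime-power order: the unique maximal proper subgroup -/

section Cyclic

variable {Q : Type*} [Group Q]

/-- If `g` has order `l ^ j` with `l` prime and `0 < j`, then `g ∉ ⟨g ^ l⟩`. [folklore] -/
private theorem not_mem_zpowers_pow {g : Q} {l j : ℕ} (hl : l.Prime) (hj : 0 < j)
    (hg : orderOf g = l ^ j) : g ∉ Subgroup.zpowers (g ^ l) := by
  intro hmem
  have hdvd : l ∣ orderOf g := hg ▸ dvd_pow_self l hj.ne'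
  have hord : orderOf (g ^ l) = l ^ (j - 1) := by
    rw [orderOf_pow_of_dvd hl.ne_zero hdvd, hg]
    conv_lhs => rw [show l ^ j = l ^ (j - 1) * l by rw [← pow_succ]; congr 1; omega]
    exact Nat.mul_div_cancel _ hl.pos
  have := orderOf_dvd_of_mem_zpowers hmem
  rw [hord, hg, Nat.pow_dvd_pow_iff_le_right hl.one_lt] at this
  omega

/-- If `g` has order `l ^ j` with `l` prime and `0 < j`, then every subgroup of `⟨g⟩` other than
`⟨g⟩` itself is contained in `⟨g ^ l⟩` (the unique maximal proper subgroup of a cyclic group of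
prime-power order). [folklore] -/
private theorem le_zpowers_pow_of_ne {g : Q} {l j : ℕ} (hl : l.Prime)
    (hg : orderOf g = l ^ j) {E : Subgroup Q} (hE : E ≤ Subgroup.zpowers g)
    (hne : E ≠ Subgroup.zpowers g) : E ≤ Subgroup.zpowers (g ^ l) := by
  intro x hx
  by_contra hxl
  obtain ⟨a, rfl⟩ := Subgroup.mem_zpowers_iff.mp (hE hx)
  -- replace the integer exponent by a natural one
  have hordpos : (0 : ℤ) < (orderOf g : ℤ) := by
    have : 0 < orderOf g := by rw [hg]; exact pow_pos hl.pos j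
    exact_mod_cast this
  set n : ℕ := (a % (orderOf g : ℤ)).toNat with hn
  have hgn : g ^ n = g ^ a := by
    rw [← zpow_natCast, hn, Int.toNat_of_nonneg (Int.emod_nonneg _ hordpos.ne'), zpow_mod_orderOf]
  -- `l ∤ n`, for otherwise `g ^ a ∈ ⟨g ^ l⟩`
  have hndvd : ¬ l ∣ n := by
    rintro ⟨m, hm⟩
    apply hxl
    rw [← hgn, hm, pow_mul]
    exact Subgroup.pow_mem _ (Subgroup.mem_zpowers _) m
  have hcop : n.Coprime (orderOf g) := by
    rw [hg]
    exact Nat.Coprime.pow_right j ((Nat.Prime.coprime_iff_not_dvd hl).mpr hndvd).symm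
  obtain ⟨m, hm⟩ := exists_pow_eq_self_of_coprime hcop
  -- hence `g ∈ E`, so `E = ⟨g⟩`
  have hgE : g ∈ E := by
    rw [← hm, hgn]
    exact Subgroup.pow_mem _ hx m
  exact hne (le_antisymm hE (Subgroup.zpowers_le.mpr hgE))

variable {P : Type*} [Group P]

/-- Elements of `U` die in `P ⧸ U`. [folklore] -/
private theorem mk'_eq_one_of_mem {U : Subgroup P} [U.Normal] {u : P} (hu : u ∈ U) :
    QuotientGroup.mk' U u = 1 := by
  rw [QuotientGroup.mk'_apply, QuotientGroup.eq_one_iff]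
  exact hu

/-- For `U ⊴ P` and `H = U ⊔ ⟨g⟩`, the commutator subgroup of `H` lies in `U` (`H / U` is
cyclic, hence abelian: the group theory behind "a cyclic finite étale covering … arises from a
finite quotient `M_G ↠ Q`" of the abelianization, [CombGC] Def. 1.1 (ii), p. 7).
[cite: MochizukiCombGC2007, Def 1.1(ii) p.7] -/
theorem commutator_le_of_sup_zpowers_eq (U H : Subgroup P) [U.Normal] {g : P}
    (hgen : U ⊔ Subgroup.zpowers g = H) : ⁅H, H⁆ ≤ U := by
  rw [Subgroup.commutator_le]
  intro x hx y hy
  rw [← QuotientGroup.ker_mk' U, MonoidHom.mem_ker, map_commutatorElement,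
    commutatorElement_eq_one_iff_commute]
  have himg : ∀ z ∈ H, ∃ a : ℤ, (QuotientGroup.mk' U g) ^ a = QuotientGroup.mk' U z := by
    intro z hz
    rw [← hgen, ← SetLike.mem_coe, Subgroup.normal_mul] at hz
    obtain ⟨u, hu, w, hw, rfl⟩ := Set.mem_mul.mp hz
    obtain ⟨a, rfl⟩ := Subgroup.mem_zpowers_iff.mp hw
    refine ⟨a, ?_⟩
    rw [map_mul, mk'_eq_one_of_mem hu, one_mul, map_zpow]
  obtain ⟨a, ha⟩ := himg x hx
  obtain ⟨b, hb⟩ := himg y hy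
  rw [← ha, ← hb]
  exact Commute.zpow_zpow_self _ a b

/-- **The Frattini subgroup of a cyclic covering of prime-power degree** (group theory behind
[CombGC] Rmk. 1.4.4 / [IUTchI] Rmk. 1.2.3 (iii), (v)): let `U ⊴ P`, `H = U ⊔ ⟨g⟩` with
`[H : U] = l ^ j`, `l` prime, `0 < j`.  Then there is a subgroup `M` with `U ≤ M ≤ H`, `M ≠ H`,
`[H : M] = l`, such that for every subgroup `E ≤ H`: `U ⊔ E = H ↔ E ⊄ M`.
[cite: MochizukiCombGC2007, Rmk 1.4.4 p.12] -/
theorem exists_frattini_of_cyclic_quotient (U H : Subgroup P) [U.Normal] {g : P}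
    (hgen : U ⊔ Subgroup.zpowers g = H) {l j : ℕ} (hl : l.Prime) (hj : 0 < j)
    (hind : U.relIndex H = l ^ j) :
    ∃ M : Subgroup P, U ≤ M ∧ M ≤ H ∧ M ≠ H ∧ M.relIndex H = l ∧
      ∀ E : Subgroup P, E ≤ H → (U ⊔ E = H ↔ ¬ E ≤ M) := by
  set f := QuotientGroup.mk' U with hf
  have hker : f.ker = U := QuotientGroup.ker_mk' U
  have hUH : U ≤ H := hgen ▸ le_sup_left
  -- the image of `H` is the cyclic group generated by the image of `g`
  have hmapU : U.map f = ⊥ := by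
    rw [Subgroup.map_eq_bot_iff, hker]
  have hHbar : H.map f = Subgroup.zpowers (f g) := by
    rw [← hgen, Subgroup.map_sup, hmapU, bot_sup_eq, MonoidHom.map_zpowers]
  have hord : orderOf (f g) = l ^ j := by
    rw [← Nat.card_zpowers, ← hHbar, ← Subgroup.relIndex_ker, hker, hind]
  have hcomapH : (H.map f).comap f = H := by
    rw [Subgroup.comap_map_eq, hker, sup_of_le_left hUH]
  refine ⟨(Subgroup.zpowers (f g ^ l)).comap f, ?_, ?_, ?_, ?_, ?_⟩
  · -- `U ≤ M`
    intro u hu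
    rw [Subgroup.mem_comap, mk'_eq_one_of_mem hu]
    exact Subgroup.one_mem _
  · -- `M ≤ H`
    rw [← hcomapH, hHbar]
    exact Subgroup.comap_mono (Subgroup.zpowers_le.mpr (Subgroup.pow_mem _ (Subgroup.mem_zpowers _) l))
  · -- `M ≠ H`
    intro hMH
    have hg : g ∈ H := hgen ▸ Subgroup.mem_sup_right (Subgroup.mem_zpowers g)
    rw [← hMH, Subgroup.mem_comap] at hg
    exact not_mem_zpowers_pow hl hj hord hg
  · -- `[H : M] = l`
    rw [Subgroup.relIndex_comap, hHbar]
    have hle : Subgroup.zpowers (f g ^ l) ≤ Subgroup.zpowers (f g) :=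
      Subgroup.zpowers_le.mpr (Subgroup.pow_mem _ (Subgroup.mem_zpowers _) l)
    have hdvd : l ∣ orderOf (f g) := hord ▸ dvd_pow_self l hj.ne'
    have hord' : orderOf (f g ^ l) * l = l ^ j := by
      rw [orderOf_pow_of_dvd hl.ne_zero hdvd, hord]
      exact Nat.div_mul_cancel (hord ▸ hdvd)
    have key : Nat.card (Subgroup.zpowers (f g ^ l)) *
        (Subgroup.zpowers (f g ^ l)).relIndex (Subgroup.zpowers (f g)) =
        Nat.card (Subgroup.zpowers (f g)) := by
      rw [Subgroup.relIndex, ← Nat.card_congr (Subgroup.subgroupOfEquivOfLe hle).toEquiv]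
      exact Subgroup.card_mul_index _
    rw [Nat.card_zpowers, Nat.card_zpowers, hord, ← hord'] at key
    have hpos : 0 < orderOf (f g ^ l) := Nat.pos_of_ne_zero fun h0 => by
      rw [h0, zero_mul] at hord'
      exact absurd hord'.symm (pow_pos hl.pos j).ne'
    exact Nat.eq_of_mul_eq_mul_left hpos key
  · -- the Frattini property
    intro E hEH
    constructor
    · intro hUE hEM
      apply not_mem_zpowers_pow hl hj hord
      have hg : g ∈ H := hgen ▸ Subgroup.mem_sup_right (Subgroup.mem_zpowers g)
      rw [← hUE] at hg
      have : U ⊔ E ≤ (Subgroup.zpowers (f g ^ l)).comap f := sup_le (fun u hu => by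
        rw [Subgroup.mem_comap, mk'_eq_one_of_mem hu]
        exact Subgroup.one_mem _) hEM
      exact (Subgroup.mem_comap.mp (this hg))
    · intro hEM
      by_contra hUE
      apply hEM
      have hEbar : E.map f ≤ Subgroup.zpowers (f g) := hHbar ▸ Subgroup.map_mono hEH
      have hne : E.map f ≠ Subgroup.zpowers (f g) := by
        intro h
        apply hUE
        have := congrArg (Subgroup.comap f) h
        rw [← hHbar, hcomapH, Subgroup.comap_map_eq, hker, sup_comm] at this
        exact this
      exact (Subgroup.le_comap_map f E).trans
        (Subgroup.comap_mono (le_zpowers_pow_of_ne hl hord hEbar hne))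

end Cyclic

end PSCCounting

end Literature.AnabelianGeometry.SemiGraphs
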